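import Literature.Computability.Complexity.BPPPathHashing
import Literature.Computability.Complexity.BlockTuples
import Literature.Computability.Complexity.CoinCounting
import HarnessLib

/-!
# Post-selected coin sets, their `t`-fold products, and the hash-index comparison deciding `PostBPP` (HHT 1997, Thm. 3.11 (1))

Topic `Computability/Complexity` (approximate counting); the finite combinatorics of
Han–Hemaspaandra–Thierauf, *Threshold computation and cryptographic security*, SIAM J. Comput. 26
(1997) 59–78 (HHT97), Thm. 3.11 (1), **`BPP_path ⊆ P^{Σ₂ᵖ[log]}`** (so `PostBPP = BPP_path ⊆ Δ₃ᵖ`,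
the named fact `Literature.Computability.QuantumComplexity.PostBPP_subset_DeltaP_three` quoted by
Bremner–Jozsa–Shepherd 2011, §3.1 eq. (1)), continuing `SipserCodingLemma.lean` (Sipser's Coding
Lemma, `SipserHash.Hashable`) and `BPPPathHashing.lean` (the hash index `k_X = SipserHash.hashIndex X`
of HHT97 Cor. 3.10 with its bounds `2^{k_X} ≤ 4|X|`, `|X| ≤ k_X·2^{k_X}`, `k_∅ = 0`, `k_X ≤ M + 2`).

HHT97's deterministic procedure (proof of Thm. 3.11 (1), pp. 15–16 of the held version): for
`L ∈ BPP_path` take a machine with `#[M(x) = L(x)] > (1 − 2^{−|x|})·total_M(x)` and let `A`, `R` be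
its accepting and rejecting paths on input `x` (`‖A‖ = acc_M(x)`, `‖R‖ = rej_M(x)`); "`Hash` is a
`Σ₂ᵖ` predicate in `x` and `k`", the least indices `k_A`, `k_R` with `Hash_A(k)`, `Hash_R(k)` "can
be computed by a binary search making at most `log p(n)` many queries", Cor. 3.10 gives
`2^{k_A − 3} ≤ acc_M(x) ≤ k_A 2^{k_A}` (likewise for `R`), and "for all but finitely many `x` we have
`x ∈ L ⟺ k_R < k_A`. This proves `L ∈ P^{Σ₂ᵖ[log]}`."

This file supplies the set-theoretic half of that argument in the tree's model of `PostBPP`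
(`Cryptography/Postselection.lean`: predicates `S` (post-select) and `R` (accept) in `P`, coins
`r ∈ {0,1}^m`, thresholds `2/3`, `1/3` conditioned on `S`):

* `accSet S R x m`, `rejSet S R x m ⊆ (Fin m → Bool)` — the post-selected accepting / rejecting coin
  vectors of `x` (HHT97's `acc_M(x)`, `rej_M(x)`), with `card_accSet_add_card_rejSet` and the link
  `cnt_eq_card_filter_ofFn` to the tree's coin counts `cnt` / `uniformProb`;
* the **promise in counting form**: `two_mul_card_rejSet_le` (`x ∈ L`: `2|rej| ≤ |acc|`, `acc ≠ ∅`)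
  and `two_mul_card_accSet_le` (`x ∉ L`: `2|acc| ≤ |rej|`, `rej ≠ ∅`) from the real inequalities of
  `PostBPP`;
* `tuplePow X t ⊆ (Fin (t·m) → Bool)` — the `t`-fold product `X^t` read blockwise
  (`BlockTuples.lean`, `Blocks.blk`), `card_tuplePow : |X^t| = |X|^t`. This replaces HHT97's appeal
  to the error-reduction normal form of their Thm. 3.1: instead of amplifying the machine we compare
  the products `acc^t` and `rej^t`, whose sizes differ by the factor `2^t` as soon as `|acc|`, `|rej|`
  differ by the factor `2` (`pow_separation`);
* **the comparison** (HHT97, proof of Thm. 3.11 (1), via Cor. 3.10): `hashIndex_lt_of_lt`: if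
  `A ≠ ∅` and `4(M+2)·|B| < |A|` then `k_B < k_A`; hence, with `t = m + 5` (so that
  `4(tm + 2) < 2^t`, `four_mul_lt_two_pow`), **`mem_iff_hashIndex_lt`**: under the `PostBPP` promise
  at `x`, `x ∈ L ↔ k_{rej^t} < k_{acc^t}` — for *every* `x` (the printed "for all but finitely many
  `x`" is absorbed by choosing `t` as a function of `m`).

The `Σ₂ᵖ` oracle `Hash` and the `P^{Σ₂ᵖ}` machine are built on top of this in
`PostBPPHashLanguage.lean` / `PostBPPDeltaThree.lean`.

## References

* Y. Han, L. A. Hemaspaandra, T. Thierauf, *Threshold computation and cryptographic security*,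
  SIAM J. Comput. 26 (1997) 59–78 (held: doi:10.1137/s0097539792240467): Def. 3.8 (pp. 14–15),
  Cor. 3.10 (p. 15), Thm. 3.11 (1) (p. 15) and its proof (pp. 15–16).
* M. Sipser, *A complexity theoretic approach to randomness*, Proc. 15th STOC (1983) 330–335.
* S. Aaronson, *Quantum computing, postselection, and probabilistic polynomial-time*, Proc. R. Soc.
  A 461 (2005), §2 (`PostBPP = BPP_path`).
-/

namespace Literature.Computability.Complexity

open Finset SipserHash Blocks

namespace PostBPPHash

/-! ### Coin counts over `Fin m → Bool` -/

/-- The tree's coin count `cnt m E` (over `List.Vector Bool m`) as a count of Boolean vectors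
`u : Fin m → Bool` read as the strings `List.ofFn u`. [folklore] -/
theorem cnt_eq_card_filter_ofFn (m : ℕ) (E : Set (List Bool)) [DecidablePred fun u : Fin m → Bool => List.ofFn u ∈ E] :
    cnt m E = (univ.filter fun u : Fin m → Bool => List.ofFn u ∈ E).card := by
  classical
  unfold cnt
  refine Finset.card_bij' (fun r _ => r.get) (fun u _ => List.Vector.ofFn u) ?_ ?_ ?_ ?_
  · intro r hr
    rw [mem_filter] at hr ⊢
    refine ⟨mem_univ _, ?_⟩
    rw [← List.Vector.toList_ofFn, List.Vector.ofFn_get]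
    exact hr.2
  · intro u hu
    rw [mem_filter] at hu ⊢
    refine ⟨mem_univ _, ?_⟩
    rw [List.Vector.toList_ofFn]
    exact hu.2
  · intro r _
    exact List.Vector.ofFn_get r
  · intro u _
    funext i
    exact List.Vector.get_ofFn u i

variable (S R : Language Bool)

/-- **`acc(x)`**: the post-selected *accepting* coin vectors of length `m` on input `x` —
`⟨x, r⟩ ∈ S` (post-selection event) and `⟨x, r⟩ ∈ R` (acceptance). (HHT97, §3: `acc_M(x)`, for
the `BPP_path` machine; Aaronson 2005, §2: the runs with post-selection bit `1` that accept.)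
[cite: HanHemaspaandraThierauf1997, Thm. 3.11 (proof)] -/
noncomputable def accSet (x : List Bool) (m : ℕ) : Finset (Fin m → Bool) := by
  classical
  exact univ.filter fun u => boolPair x (List.ofFn u) ∈ S ∧ boolPair x (List.ofFn u) ∈ R

/-- **`rej(x)`**: the post-selected *rejecting* coin vectors of length `m` on input `x` —
`⟨x, r⟩ ∈ S` and `⟨x, r⟩ ∉ R`. (HHT97, §3: `rej_M(x)`.) [cite: HanHemaspaandraThierauf1997, Thm. 3.11 (proof)] -/
noncomputable def rejSet (x : List Bool) (m : ℕ) : Finset (Fin m → Bool) := by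
  classical
  exact univ.filter fun u => boolPair x (List.ofFn u) ∈ S ∧ boolPair x (List.ofFn u) ∉ R

variable {S R}

/-- Membership in `accSet`. [folklore] -/
@[simp] theorem mem_accSet {x : List Bool} {m : ℕ} {u : Fin m → Bool} :
    u ∈ accSet S R x m ↔ boolPair x (List.ofFn u) ∈ S ∧ boolPair x (List.ofFn u) ∈ R := by
  classical
  simp [accSet]

/-- Membership in `rejSet`. [folklore] -/
@[simp] theorem mem_rejSet {x : List Bool} {m : ℕ} {u : Fin m → Bool} :
    u ∈ rejSet S R x m ↔ boolPair x (List.ofFn u) ∈ S ∧ boolPair x (List.ofFn u) ∉ R := by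
  classical
  simp [rejSet]

variable (S R)

/-- `|acc(x)|` is the coin count of the event `S ∧ R`. [folklore] -/
theorem card_accSet (x : List Bool) (m : ℕ) :
    (accSet S R x m).card = cnt m {r | boolPair x r ∈ S ∧ boolPair x r ∈ R} := by
  classical
  rw [cnt_eq_card_filter_ofFn]
  congr 1

/-- `|rej(x)|` is the coin count of the event `S ∧ ¬R`. [folklore] -/
theorem card_rejSet (x : List Bool) (m : ℕ) :
    (rejSet S R x m).card = cnt m {r | boolPair x r ∈ S ∧ boolPair x r ∉ R} := by
  classical
  rw [cnt_eq_card_filter_ofFn]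
  congr 1

/-- `|acc(x)| + |rej(x)|` is the coin count of the post-selection event `S`. [folklore] -/
theorem card_accSet_add_card_rejSet (x : List Bool) (m : ℕ) :
    (accSet S R x m).card + (rejSet S R x m).card = cnt m {r | boolPair x r ∈ S} := by
  classical
  rw [cnt_eq_card_filter_ofFn]
  have h := card_filter_add_card_filter_not
    (s := univ.filter fun u : Fin m → Bool => boolPair x (List.ofFn u) ∈ S)
    (fun u => boolPair x (List.ofFn u) ∈ R)
  rw [filter_filter, filter_filter] at h
  convert h using 2
  · simp [accSet]
  · simp [rejSet]
  · exact filter_congr fun u _ => by simp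

/-! ### The promise in counting form -/

/-- Real-to-natural bookkeeping: `uniformProb m E = cnt m E / 2^m` with `2^m > 0`. [folklore] -/
theorem uniformProb_le_iff_of_mul {m : ℕ} {E F : Set (List Bool)} {a b : ℕ} :
    (a : ℝ) * uniformProb m E ≤ (b : ℝ) * uniformProb m F ↔ a * cnt m E ≤ b * cnt m F := by
  rw [uniformProb_eq_cnt_div, uniformProb_eq_cnt_div, mul_div_assoc', mul_div_assoc',
    div_le_div_iff_of_pos_right (by positivity)]
  exact_mod_cast Iff.rfl

/-- **`x ∈ L` in counting form**: if `Pr[S] > 0` and `2/3 · Pr[S] ≤ Pr[S ∧ R]` then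
`2·|rej(x)| ≤ |acc(x)|` and `acc(x) ≠ ∅` (paraphrasing HHT97's normal form
`#[M(x) = L(x)] > (1 − 2^{−|x|})·total_M(x)` at the tree's threshold `2/3`). [cite: HanHemaspaandraThierauf1997, Thm. 3.11 (proof)] -/
theorem two_mul_card_rejSet_le {x : List Bool} {m : ℕ}
    (h0 : 0 < uniformProb m {r | boolPair x r ∈ S})
    (h : 2 / 3 * uniformProb m {r | boolPair x r ∈ S} ≤
      uniformProb m {r | boolPair x r ∈ S ∧ boolPair x r ∈ R}) :
    2 * (rejSet S R x m).card ≤ (accSet S R x m).card ∧ (accSet S R x m).Nonempty := by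
  have h' : (2 : ℕ) * cnt m {r | boolPair x r ∈ S} ≤ 3 * cnt m {r | boolPair x r ∈ S ∧ boolPair x r ∈ R} := by
    rw [← uniformProb_le_iff_of_mul]
    push_cast
    linarith
  have hS : 0 < cnt m {r | boolPair x r ∈ S} := by
    rw [uniformProb_eq_cnt_div] at h0
    have : (0 : ℝ) < cnt m {r | boolPair x r ∈ S} := by
      by_contra hle
      push Not at hle
      have : (cnt m {r | boolPair x r ∈ S} : ℝ) / 2 ^ m ≤ 0 := div_nonpos_of_nonpos_of_nonneg hle (by positivity)
      linarith
    exact_mod_cast this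
  rw [← card_accSet_add_card_rejSet S R] at h' hS
  rw [← card_accSet S R] at h'
  refine ⟨by omega, card_pos.1 (by omega)⟩

/-- **`x ∉ L` in counting form**: if `Pr[S] > 0` and `Pr[S ∧ R] ≤ 1/3 · Pr[S]` then
`2·|acc(x)| ≤ |rej(x)|` and `rej(x) ≠ ∅` (the rejecting side of the same paraphrase).
[cite: HanHemaspaandraThierauf1997, Thm. 3.11 (proof)] -/
theorem two_mul_card_accSet_le {x : List Bool} {m : ℕ}
    (h0 : 0 < uniformProb m {r | boolPair x r ∈ S})
    (h : uniformProb m {r | boolPair x r ∈ S ∧ boolPair x r ∈ R} ≤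
      1 / 3 * uniformProb m {r | boolPair x r ∈ S}) :
    2 * (accSet S R x m).card ≤ (rejSet S R x m).card ∧ (rejSet S R x m).Nonempty := by
  have h' : (3 : ℕ) * cnt m {r | boolPair x r ∈ S ∧ boolPair x r ∈ R} ≤ 1 * cnt m {r | boolPair x r ∈ S} := by
    rw [← uniformProb_le_iff_of_mul]
    push_cast
    linarith
  have hS : 0 < cnt m {r | boolPair x r ∈ S} := by
    rw [uniformProb_eq_cnt_div] at h0
    have : (0 : ℝ) < cnt m {r | boolPair x r ∈ S} := by
      by_contra hle
      push Not at hle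
      have : (cnt m {r | boolPair x r ∈ S} : ℝ) / 2 ^ m ≤ 0 := div_nonpos_of_nonpos_of_nonneg hle (by positivity)
      linarith
    exact_mod_cast this
  rw [← card_accSet_add_card_rejSet S R] at h' hS
  rw [← card_accSet S R] at h'
  refine ⟨by omega, card_pos.1 (by omega)⟩

/-! ### `t`-fold products of coin sets -/

variable {m : ℕ}

/-- **`X^t`**: the vectors of `t` blocks of length `m` all of whose blocks lie in `X` (the coin
vectors of `t` independent runs that all land in `X`; Arora–Barak 2009, §7.4.1). This is the device
*replacing* HHT97's use of their Thm. 3.1 normal form, see the module docstring. [folklore] -/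
noncomputable def tuplePow (X : Finset (Fin m → Bool)) (t : ℕ) : Finset (Fin (t * m) → Bool) := by
  classical
  exact univ.filter fun U => ∀ j : Fin t, blk U j ∈ X

/-- Membership in `tuplePow`. [folklore] -/
@[simp] theorem mem_tuplePow {X : Finset (Fin m → Bool)} {t : ℕ} {U : Fin (t * m) → Bool} :
    U ∈ tuplePow X t ↔ ∀ j : Fin t, blk U j ∈ X := by
  classical
  simp [tuplePow]

/-- `X^t` is the image of the `t`-fold pi-finset of `X` under the tupling equivalence. [folklore] -/
theorem tuplePow_eq_map (X : Finset (Fin m → Bool)) (t : ℕ) :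
    tuplePow X t = (Fintype.piFinset fun _ : Fin t => X).map (tupleEquiv t m).toEmbedding := by
  classical
  ext U
  rw [mem_tuplePow, mem_map]
  constructor
  · intro h
    exact ⟨blk U, Fintype.mem_piFinset.2 h, tupleEquiv_blk U⟩
  · rintro ⟨f, hf, rfl⟩ j
    rw [Equiv.coe_toEmbedding, blk_tupleEquiv]
    exact Fintype.mem_piFinset.1 hf j

/-- **`|X^t| = |X|^t`.** [folklore] -/
theorem card_tuplePow (X : Finset (Fin m → Bool)) (t : ℕ) : (tuplePow X t).card = X.card ^ t := by
  rw [tuplePow_eq_map, card_map, Fintype.card_piFinset_const]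

/-- `X^t` is nonempty when `X` is. [folklore] -/
theorem tuplePow_nonempty {X : Finset (Fin m → Bool)} (hX : X.Nonempty) (t : ℕ) : (tuplePow X t).Nonempty := by
  rw [← card_pos, card_tuplePow]
  exact pow_pos (card_pos.2 hX) t

/-- **Separation of the products**: `2|B| ≤ |A|` gives `c·|B^t| < |A^t|` for every `c < 2^t`
(if `A ≠ ∅`). [folklore] -/
theorem pow_separation {A B : Finset (Fin m → Bool)} {t c : ℕ} (hA : A.Nonempty) (hAB : 2 * B.card ≤ A.card)
    (hc : c < 2 ^ t) : c * (tuplePow B t).card < (tuplePow A t).card := by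
  rw [card_tuplePow, card_tuplePow]
  have hpow : 2 ^ t * B.card ^ t ≤ A.card ^ t := by
    rw [← mul_pow]
    exact Nat.pow_le_pow_left hAB t
  rcases Nat.eq_zero_or_pos (B.card ^ t) with h0 | hpos
  · rw [h0, mul_zero]
    exact pow_pos (card_pos.2 hA) t
  · calc c * B.card ^ t < 2 ^ t * B.card ^ t := Nat.mul_lt_mul_of_lt_of_le hc le_rfl hpos
      _ ≤ A.card ^ t := hpow

/-! ### Comparing hash indices (HHT97, proof of Thm. 3.11 (1)) -/

variable {M : ℕ}

/-- **The comparison lemma.** If `A ≠ ∅` and `4(M+2)·|B| < |A|` then `k_B < k_A`: otherwise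
`|A| ≤ k_A·2^{k_A} ≤ (M+2)·2^{k_B} ≤ (M+2)·4|B|` by the two bounds of Cor. 3.10 (and `k_B = 0`
forces `k_A = 0`, impossible for nonempty `A`). This is the step HHT97 leave as "it is not difficult
to see that for all but finitely many `x` we have `x ∈ L ⟺ k_R < k_A`" (proof of Thm. 3.11 (1), via
Cor. 3.10). [cite: HanHemaspaandraThierauf1997, Thm. 3.11 (proof)] -/
theorem hashIndex_lt_of_lt (A B : Finset (Fin M → Bool)) (hA : A.Nonempty)
    (h : 4 * (M + 2) * B.card < A.card) : hashIndex B < hashIndex A := by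
  by_contra hle
  push Not at hle
  have h1 : A.card ≤ hashIndex A * 2 ^ hashIndex A := card_le_hashIndex_mul_two_pow A
  have hA1 : 1 ≤ hashIndex A := one_le_hashIndex A hA
  rcases B.eq_empty_or_nonempty with hB | hB
  · rw [hB, hashIndex_empty] at hle
    omega
  · have h2 : 2 ^ hashIndex B ≤ 4 * B.card := two_pow_hashIndex_le B hB
    have h3 : hashIndex A ≤ M + 2 := hashIndex_le_add_two A
    have h4 : 2 ^ hashIndex A ≤ 2 ^ hashIndex B := Nat.pow_le_pow_right two_pos hle
    have : A.card ≤ (M + 2) * (4 * B.card) :=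
      h1.trans (Nat.mul_le_mul h3 (h4.trans h2))
    have : 4 * (M + 2) * B.card < (M + 2) * (4 * B.card) := h.trans_le this
    rw [mul_comm 4 (M + 2), mul_assoc] at this
    exact lt_irrefl _ this

/-- The symmetric conclusion: if `B ≠ ∅` and `4(M+2)·|A| < |B|` then `¬ k_B < k_A`. [cite: HanHemaspaandraThierauf1997, Thm. 3.11 (proof)] -/
theorem not_hashIndex_lt_of_lt (A B : Finset (Fin M → Bool)) (hB : B.Nonempty)
    (h : 4 * (M + 2) * A.card < B.card) : ¬ hashIndex B < hashIndex A :=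
  lt_asymm (hashIndex_lt_of_lt B A hB h)

/-! ### The number of runs -/

/-- The number of runs compared: `t = m + 5` for coin length `m`. [folklore] -/
def runs (m : ℕ) : ℕ := m + 5

/-- **`4((m+5)·m + 2) < 2^{m+5}`**: with `t = m + 5` runs the factor `2^t` beats the cap
`4(M + 2)`, `M = t·m`, of the comparison lemma. [folklore] -/
theorem four_mul_lt_two_pow (m : ℕ) : 4 * (runs m * m + 2) < 2 ^ runs m := by
  unfold runs
  induction m with
  | zero => norm_num
  | succ n ih =>
    rcases Nat.eq_zero_or_pos n with rfl | hn
    · norm_num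
    · have hstep : 4 * ((n + 1 + 5) * (n + 1) + 2) ≤ 2 * (4 * ((n + 5) * n + 2)) := by nlinarith
      calc 4 * ((n + 1 + 5) * (n + 1) + 2) ≤ 2 * (4 * ((n + 5) * n + 2)) := hstep
        _ < 2 * 2 ^ (n + 5) := by omega
        _ = 2 ^ (n + 1 + 5) := by ring

/-! ### The decision criterion -/

/-- **`x ∈ L` implies `k_{rej^t} < k_{acc^t}`** (`t = m + 5`). [cite: HanHemaspaandraThierauf1997, Thm. 3.11 (proof)] -/
theorem hashIndex_lt_of_promise {x : List Bool} {m : ℕ}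
    (h0 : 0 < uniformProb m {r | boolPair x r ∈ S})
    (h : 2 / 3 * uniformProb m {r | boolPair x r ∈ S} ≤
      uniformProb m {r | boolPair x r ∈ S ∧ boolPair x r ∈ R}) :
    hashIndex (tuplePow (rejSet S R x m) (runs m)) < hashIndex (tuplePow (accSet S R x m) (runs m)) := by
  obtain ⟨hle, hA⟩ := two_mul_card_rejSet_le S R h0 h
  exact hashIndex_lt_of_lt _ _ (tuplePow_nonempty hA _)
    (pow_separation hA hle (four_mul_lt_two_pow m))

/-- **`x ∉ L` implies `¬ k_{rej^t} < k_{acc^t}`** (`t = m + 5`). [cite: HanHemaspaandraThierauf1997, Thm. 3.11 (proof)] -/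
theorem not_hashIndex_lt_of_promise {x : List Bool} {m : ℕ}
    (h0 : 0 < uniformProb m {r | boolPair x r ∈ S})
    (h : uniformProb m {r | boolPair x r ∈ S ∧ boolPair x r ∈ R} ≤
      1 / 3 * uniformProb m {r | boolPair x r ∈ S}) :
    ¬ hashIndex (tuplePow (rejSet S R x m) (runs m)) < hashIndex (tuplePow (accSet S R x m) (runs m)) := by
  obtain ⟨hle, hB⟩ := two_mul_card_accSet_le S R h0 h
  exact not_hashIndex_lt_of_lt _ _ (tuplePow_nonempty hB _)
    (pow_separation hB hle (four_mul_lt_two_pow m))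

/-- **HHT97 Thm. 3.11 (1), the criterion.** Under the `PostBPP` promise at `x` with coin length
`m` (post-selection has positive probability; conditional acceptance `≥ 2/3` if `x ∈ L`, `≤ 1/3`
if `x ∉ L`), membership is the comparison of two hash indices:
`x ∈ L ↔ k_{rej(x)^t} < k_{acc(x)^t}`, `t = m + 5`. (HHT97, p. 16: "`x ∈ L ⟺ k_R < k_A`".)
[cite: HanHemaspaandraThierauf1997, Thm. 3.11 (1)] -/
theorem mem_iff_hashIndex_lt {L : Language Bool} {x : List Bool} {m : ℕ}
    (h0 : 0 < uniformProb m {r | boolPair x r ∈ S})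
    (hyes : x ∈ L → 2 / 3 * uniformProb m {r | boolPair x r ∈ S} ≤
      uniformProb m {r | boolPair x r ∈ S ∧ boolPair x r ∈ R})
    (hno : x ∉ L → uniformProb m {r | boolPair x r ∈ S ∧ boolPair x r ∈ R} ≤
      1 / 3 * uniformProb m {r | boolPair x r ∈ S}) :
    x ∈ L ↔ hashIndex (tuplePow (rejSet S R x m) (runs m)) < hashIndex (tuplePow (accSet S R x m) (runs m)) := by
  by_cases hx : x ∈ L
  · exact iff_of_true hx (hashIndex_lt_of_promise S R h0 (hyes hx))
  · exact iff_of_false hx (not_hashIndex_lt_of_promise S R h0 (hno hx))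

end PostBPPHash

end Literature.Computability.Complexity
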